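import Mathlib
import Summits.KontsevichZagierPeriods.Zeta5Search.Denom.CatalanQBridgeProof
import Literature.InformationTheory.Entropy.MultinomialBound
import HarnessLib

/-!
# Catalan box family — an elementary archimedean bound for the `G`-coefficient on the shifted rays

HONEST FRAMING: systematic search; no irrationality claim unless certified.  Cell `pub-zeta5`, seat fam-catalan
(gen 2; `run/shared/lean/pub/pub-zeta5/families/catalan/TWOADIC.md` §7, §11–§12).  Nothing here is a claim about the
arithmetic nature of Catalan's constant `G` or of the 2-adic constant `ξ`; this file is elementary combinatorics of an
explicit finite sum.

THE BOUND.  On the parameter sets `(h, j, k, l, m) = (n, J, n, J + n, n)` (which contain the 2-adic rays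
`(n, jn, n, (j+1)n, n)` of `CatalanTwoAdicRay.lean`, `J = jn`), every summand of fam-denom's closed form
`Denom.CatalanBox.QClosed = Σ_{i ≤ J} qTerm i` (= fam-catalan's `catalanQ` by the tree theorem `catalanQ_eq_QClosed`) is of
type A, and

  `|qTerm n J n (J+n) n i| ≤ 8 · C(n+i, n)`            (`abs_qTerm_shift_le`),

whence `|catalanQ n J n (J+n) n| ≤ 8 (J+1) · C(J+n, n)` (`abs_catalanQ_shift_le`) and, on the rays, with the ENTROPY
bound `C(a+b, a) · a^a · b^b ≤ (a+b)^(a+b)` (the tree's `Literature.InformationTheory.Entropy.choose_mul_pow_mul_pow_le`),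

  `|catalanQ n (jn) n ((j+1)n) n| ≤ 8 (jn+1) · exp (b_j · n)`,  `b_j = (j+1) log (j+1) − j log j`   (`abs_catalanQ_ray_le_exp`)

— EXACTLY the growth rate certified numerically by the zeta5-calc lane (two exact routes, j = 5, 6, 8, 10, 12; the rate is
the entropy of `C((j+1)n, n)`, i.e. the endpoint term `i = jn` dominates, TWOADIC.md §7).  The proof is two factorial
inequalities (`factorial_sq_le`, `factorial_mul_sq_le`), the termwise envelope `|∏_{e<s}(2e+1−2N)| ≤ 2^s ∏ max(N−e, e+1−N)`
and `C(2k,k) ≤ 4^k`; no Stirling formula and no certified logarithms are used.  The sequel `CatalanTwoAdicRayBound.lean`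
turns this into the unconditional growth input of the 2-adic ray chain (`ray_measure_explicit`).
-/

namespace Summit.KontsevichZagierPeriods.Zeta5Search.CatalanTwoAdicSeries

open Finset Nat Real
open Summit.KontsevichZagierPeriods.Zeta5Search.Denom.CatalanBox
  (oddProd F1 superCatalan qTerm qSum QClosed qSum_eq_sum catalanQ_eq_QClosed)
open Summit.KontsevichZagierPeriods.Zeta5Search.KernelKit (binomF binomF_eq)
open Summit.KontsevichZagierPeriods.Zeta5Search.CatalanQSum (catalanQ)

/-! ### Two factorial inequalities -/

/-- `n!·n! ≤ (n−m)!·(n+m)!` for `m ≤ n` (log-convexity of the factorial). -/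
theorem factorial_sq_le (n m : ℕ) (hm : m ≤ n) : n ! * n ! ≤ (n - m)! * (n + m)! := by
  have h1 : (n - m)! * n.descFactorial m = n ! := Nat.factorial_mul_descFactorial hm
  have h2 : ((n + m) - m)! * (n + m).descFactorial m = (n + m)! := Nat.factorial_mul_descFactorial (by omega)
  rw [Nat.add_sub_cancel] at h2
  have h3 : n.descFactorial m ≤ (n + m).descFactorial m := Nat.descFactorial_le m (by omega)
  calc n ! * n ! = (n - m)! * n.descFactorial m * n ! := by rw [h1]
    _ ≤ (n - m)! * (n + m).descFactorial m * n ! := by gcongr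
    _ = (n - m)! * (n ! * (n + m).descFactorial m) := by ring
    _ = (n - m)! * (n + m)! := by rw [h2]

/-- `(m−n)!·n!·n! ≤ (n+m)!` for `n ≤ m`. -/
theorem factorial_mul_sq_le (n m : ℕ) (hm : n ≤ m) : (m - n)! * (n ! * n !) ≤ (n + m)! := by
  have h1 : n ! * n ! ≤ (n + n)! :=
    Nat.le_of_dvd (factorial_pos _) (Nat.factorial_mul_factorial_dvd_factorial_add n n)
  have h2 : (m - n)! * (n + n)! ≤ ((m - n) + (n + n))! :=
    Nat.le_of_dvd (factorial_pos _) (Nat.factorial_mul_factorial_dvd_factorial_add _ _)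
  have h3 : (m - n) + (n + n) = n + m := by omega
  calc (m - n)! * (n ! * n !) ≤ (m - n)! * (n + n)! := Nat.mul_le_mul_left _ h1
    _ ≤ (n + m)! := by rw [← h3]; exact h2

/-! ### The envelope product -/

/-- The envelope product `P_N(s) = ∏_{e<s} max(N−e, e+1−N)` in closed form. -/
theorem prod_max_eq (N s : ℕ) :
    ∏ e ∈ range s, max (N - e) (e + 1 - N) = N.descFactorial (min s N) * (s - N)! := by
  induction s with
  | zero => simp
  | succ s ih =>
    rw [Finset.prod_range_succ, ih]
    rcases lt_or_ge s N with h | h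
    · rw [min_eq_left h.le, min_eq_left (by omega : s + 1 ≤ N), show s - N = 0 by omega,
        show s + 1 - N = 0 by omega, max_eq_left (by omega : 0 ≤ N - s), Nat.descFactorial_succ]
      simp only [Nat.factorial_zero, mul_one]
      ring
    · rw [min_eq_right h, min_eq_right (by omega : N ≤ s + 1), show N - s = 0 by omega,
        max_eq_right (by omega : 0 ≤ s + 1 - N), show s + 1 - N = (s - N) + 1 by omega, Nat.factorial_succ]
      ring

/-- MASTER INEQUALITY: `P_{n+i}(i+m) · n! · n! ≤ (n+i)! · (n+m)!`. -/
theorem prod_max_mul_le (n i m : ℕ) :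
    (∏ e ∈ range (i + m), max (n + i - e) (e + 1 - (n + i))) * (n ! * n !) ≤ (n + i)! * (n + m)! := by
  rw [prod_max_eq]
  rcases Nat.lt_or_ge n m with h | h
  · rw [min_eq_right (by omega : n + i ≤ i + m), Nat.descFactorial_self,
      show i + m - (n + i) = m - n by omega]
    calc (n + i)! * (m - n)! * (n ! * n !) = (n + i)! * ((m - n)! * (n ! * n !)) := by ring
      _ ≤ (n + i)! * (n + m)! := Nat.mul_le_mul_left _ (factorial_mul_sq_le n m h.le)
  · rw [min_eq_left (by omega : i + m ≤ n + i), show i + m - (n + i) = 0 by omega, Nat.factorial_zero, mul_one]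
    have hd : (n + i - (i + m))! * (n + i).descFactorial (i + m) = (n + i)! :=
      Nat.factorial_mul_descFactorial (by omega)
    rw [show n + i - (i + m) = n - m by omega] at hd
    calc (n + i).descFactorial (i + m) * (n ! * n !)
        ≤ (n + i).descFactorial (i + m) * ((n - m)! * (n + m)!) :=
          Nat.mul_le_mul_left _ (factorial_sq_le n m h)
      _ = ((n - m)! * (n + i).descFactorial (i + m)) * (n + m)! := by ring
      _ = (n + i)! * (n + m)! := by rw [hd]

/-- `|oddProd (l − N) l s| ≤ 2^s · P_N(s)`: the factors of `oddProd` are `2e + 1 − 2N`, `e < s`. -/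
theorem abs_oddProd_le (N l s : ℕ) :
    |((oddProd ((l : ℤ) - N) l s : ℤ) : ℚ)|
      ≤ (2 : ℚ) ^ s * ((∏ e ∈ range s, max (N - e) (e + 1 - N) : ℕ) : ℚ) := by
  induction s with
  | zero => simp [oddProd]
  | succ s ih =>
    rw [oddProd, Int.cast_mul, abs_mul, Finset.prod_range_succ, Nat.cast_mul, pow_succ]
    have hf : |((2 * ((l : ℤ) - N) - 2 * (l : ℕ) + 1 + 2 * (s : ℕ) : ℤ) : ℚ)|
        ≤ 2 * ((max (N - s) (s + 1 - N) : ℕ) : ℚ) := by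
      rcases Nat.lt_or_ge s N with h | h
      · rw [max_eq_left (by omega : s + 1 - N ≤ N - s)]
        push_cast [Nat.cast_sub h.le]
        have h' : (s : ℚ) + 1 ≤ N := by exact_mod_cast h
        rw [abs_le]
        constructor <;> linarith
      · rw [max_eq_right (by omega : N - s ≤ s + 1 - N)]
        push_cast [Nat.cast_sub (by omega : N ≤ s + 1)]
        have h' : (N : ℚ) ≤ s := by exact_mod_cast h
        rw [abs_le]
        constructor <;> linarith
    calc |((oddProd ((l : ℤ) - N) l s : ℤ) : ℚ)| * |((2 * ((l : ℤ) - N) - 2 * (l : ℕ) + 1 + 2 * (s : ℕ) : ℤ) : ℚ)|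
        ≤ ((2 : ℚ) ^ s * ((∏ e ∈ range s, max (N - e) (e + 1 - N) : ℕ) : ℚ))
            * (2 * ((max (N - s) (s + 1 - N) : ℕ) : ℚ)) :=
          mul_le_mul ih hf (abs_nonneg _) (by positivity)
      _ = (2 : ℚ) ^ s * 2 * (((∏ e ∈ range s, max (N - e) (e + 1 - N) : ℕ) : ℚ)
            * ((max (N - s) (s + 1 - N) : ℕ) : ℚ)) := by ring

/-! ### The termwise bound -/

/-- KEY (in `ℕ`): with `N = n+i`, `s = i+mm`, `A = |oddProd|`-envelope:
`C(s,i) · P · (2n)! · (2mm)! · n! · i! ≤ (n+i)! · s! · n! · mm! · (n+mm)! · 4^(n+mm)`. -/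
theorem key_nat (n i mm : ℕ) :
    (i + mm).choose i * (∏ e ∈ range (i + mm), max (n + i - e) (e + 1 - (n + i)))
        * (2 * n)! * (2 * mm)! * n ! * i !
      ≤ (n + i)! * (i + mm)! * n ! * mm ! * (n + mm)! * 4 ^ (n + mm) := by
  set P := ∏ e ∈ range (i + mm), max (n + i - e) (e + 1 - (n + i)) with hP
  have hC : (i + mm).choose i * i ! * mm ! = (i + mm)! := by
    have := Nat.choose_mul_factorial_mul_factorial (show i ≤ i + mm by omega)
    rwa [Nat.add_sub_cancel_left] at this
  have h2n : (2 * n)! ≤ 4 ^ n * (n ! * n !) := by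
    have h := Nat.choose_mul_factorial_mul_factorial (show n ≤ 2 * n by omega)
    rw [show 2 * n - n = n by omega] at h
    rw [← h]
    have := (Nat.centralBinom_eq_two_mul_choose n) ▸ Nat.centralBinom_le_four_pow n
    calc (2 * n).choose n * n ! * n ! = (2 * n).choose n * (n ! * n !) := by ring
      _ ≤ 4 ^ n * (n ! * n !) := Nat.mul_le_mul_right _ this
  have h2m : (2 * mm)! ≤ 4 ^ mm * (mm ! * mm !) := by
    have h := Nat.choose_mul_factorial_mul_factorial (show mm ≤ 2 * mm by omega)
    rw [show 2 * mm - mm = mm by omega] at h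
    rw [← h]
    have := (Nat.centralBinom_eq_two_mul_choose mm) ▸ Nat.centralBinom_le_four_pow mm
    calc (2 * mm).choose mm * mm ! * mm ! = (2 * mm).choose mm * (mm ! * mm !) := by ring
      _ ≤ 4 ^ mm * (mm ! * mm !) := Nat.mul_le_mul_right _ this
  have hM := prod_max_mul_le n i mm
  rw [← hP] at hM
  calc (i + mm).choose i * P * (2 * n)! * (2 * mm)! * n ! * i !
      ≤ (i + mm).choose i * P * (4 ^ n * (n ! * n !)) * (4 ^ mm * (mm ! * mm !)) * n ! * i ! := by
        gcongr
    _ = ((i + mm).choose i * i ! * mm !) * (P * (n ! * n !)) * n ! * mm ! * (4 ^ n * 4 ^ mm) := by ring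
    _ ≤ ((i + mm).choose i * i ! * mm !) * ((n + i)! * (n + mm)!) * n ! * mm ! * (4 ^ n * 4 ^ mm) := by
        gcongr
    _ = (n + i)! * (i + mm)! * n ! * mm ! * (n + mm)! * 4 ^ (n + mm) := by rw [hC, pow_add]; ring

/-- On the shifted rays every summand is of type A and explicitly
`|qTerm n J n (J+n) n i| = 8 · C(J,i) · |oddProd (J−i) (J+n) J| /(2^J J!) · S(n, J−i)/4^(n+J−i)`. -/
theorem abs_qTerm_shift_eq (n J i : ℕ) (hi : i ≤ J) :
    |qTerm n J n (J + n) n i|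
      = 8 * (J.choose i : ℚ) * (|((oddProd (((J + n : ℕ) : ℤ) - ((n + i : ℕ) : ℤ)) (J + n) J : ℤ) : ℚ)|
          / ((2 : ℚ) ^ J * (J ! : ℚ))) * (superCatalan n (J - i) / (4 : ℚ) ^ (n + (J - i))) := by
  unfold qTerm
  simp only [binomF_eq]
  have hs : J + n - n = J := by omega
  have ha : (n : ℤ) - ((J + n : ℕ) : ℤ) + (i : ℤ) ≤ 0 := by push_cast; omega
  rw [if_pos ha, hs]
  have hneg : -((n : ℤ) - ((J + n : ℕ) : ℤ) + (i : ℤ)) = ((J - i : ℕ) : ℤ) := by push_cast; omega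
  have hneg' : (((J + n : ℕ) : ℤ) - ((n + i : ℕ) : ℤ)) = ((J - i : ℕ) : ℤ) := by push_cast; omega
  rw [hneg, Int.toNat_natCast, hneg']
  unfold F1
  have hSC : 0 ≤ superCatalan n (J - i) := by unfold superCatalan; positivity
  rw [abs_div, abs_mul, abs_mul, abs_mul, abs_mul, abs_of_nonneg hSC, abs_pow, abs_pow, abs_neg, abs_one, one_pow,
    abs_of_nonneg (by positivity : (0 : ℚ) ≤ 8), abs_of_nonneg (by positivity : (0 : ℚ) ≤ (J.choose i : ℚ)),
    abs_div, abs_of_nonneg (by positivity : (0 : ℚ) ≤ (2 : ℚ) ^ J * (J ! : ℚ)),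
    abs_of_nonneg (by positivity : (0 : ℚ) ≤ 4)]
  ring

/-- **Termwise bound on the shifted rays**: `|qTerm n J n (J+n) n i| ≤ 8 · C(n+i, n)` for `i ≤ J`. -/
theorem abs_qTerm_shift_le (n J i : ℕ) (hi : i ≤ J) :
    |qTerm n J n (J + n) n i| ≤ 8 * ((n + i).choose n : ℚ) := by
  rw [abs_qTerm_shift_eq n J i hi]
  obtain ⟨mm, rfl⟩ : ∃ mm, J = i + mm := ⟨J - i, by omega⟩
  rw [show i + mm - i = mm by omega, show i + mm + n = (i + mm) + n from rfl]
  set P : ℕ := ∏ e ∈ range (i + mm), max (n + i - e) (e + 1 - (n + i)) with hP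
  have hO := abs_oddProd_le (n + i) (i + mm + n) (i + mm)
  rw [← hP] at hO
  have hkey := key_nat n i mm
  rw [← hP] at hkey
  -- the binomial coefficient `C(n+i, n) = (n+i)!/(n! i!)`
  have hCn : ((n + i).choose n : ℚ) * (n ! : ℚ) * (i ! : ℚ) = ((n + i)! : ℚ) := by
    have := Nat.choose_mul_factorial_mul_factorial (show n ≤ n + i by omega)
    rw [Nat.add_sub_cancel_left] at this
    exact_mod_cast this
  have hkeyQ : (((i + mm).choose i : ℕ) : ℚ) * (P : ℚ) * ((2 * n)! : ℚ) * ((2 * mm)! : ℚ) * (n ! : ℚ) * (i ! : ℚ)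
      ≤ ((n + i)! : ℚ) * ((i + mm)! : ℚ) * (n ! : ℚ) * (mm ! : ℚ) * ((n + mm)! : ℚ) * (4 : ℚ) ^ (n + mm) := by
    exact_mod_cast hkey
  unfold superCatalan
  have hn0 : (0 : ℚ) < n ! := by positivity
  have hi0 : (0 : ℚ) < i ! := by positivity
  -- bound |oddProd| by the envelope, then clear denominators
  calc 8 * ((i + mm).choose i : ℚ) * (|((oddProd (((i + mm + n : ℕ) : ℤ) - ((n + i : ℕ) : ℤ)) (i + mm + n) (i + mm) : ℤ) : ℚ)|
          / ((2 : ℚ) ^ (i + mm) * ((i + mm)! : ℚ)))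
        * (((2 * n)! : ℚ) * ((2 * mm)! : ℚ) / ((n ! : ℚ) * (mm ! : ℚ) * ((n + mm)! : ℚ)) / (4 : ℚ) ^ (n + mm))
      ≤ 8 * ((i + mm).choose i : ℚ) * ((2 : ℚ) ^ (i + mm) * (P : ℚ) / ((2 : ℚ) ^ (i + mm) * ((i + mm)! : ℚ)))
        * (((2 * n)! : ℚ) * ((2 * mm)! : ℚ) / ((n ! : ℚ) * (mm ! : ℚ) * ((n + mm)! : ℚ)) / (4 : ℚ) ^ (n + mm)) := by
        gcongr
    _ = (((i + mm).choose i : ℕ) : ℚ) * (P : ℚ) * ((2 * n)! : ℚ) * ((2 * mm)! : ℚ) * (n ! : ℚ) * (i ! : ℚ)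
          * (8 / (((i + mm)! : ℚ) * (n ! : ℚ) * (mm ! : ℚ) * ((n + mm)! : ℚ) * (4 : ℚ) ^ (n + mm) * (n ! * i !))) := by
        field_simp
    _ ≤ ((n + i)! : ℚ) * ((i + mm)! : ℚ) * (n ! : ℚ) * (mm ! : ℚ) * ((n + mm)! : ℚ) * (4 : ℚ) ^ (n + mm)
          * (8 / (((i + mm)! : ℚ) * (n ! : ℚ) * (mm ! : ℚ) * ((n + mm)! : ℚ) * (4 : ℚ) ^ (n + mm) * (n ! * i !))) := by
        gcongr
    _ = 8 * (((n + i)! : ℚ) / ((n ! : ℚ) * (i ! : ℚ))) := by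
        field_simp
    _ = 8 * ((n + i).choose n : ℚ) := by
        rw [← hCn]; field_simp

/-! ### The sum -/

/-- **The `G`-coefficient on the shifted rays**: `|catalanQ n J n (J+n) n| ≤ 8 (J+1) · C(J+n, n)`. -/
theorem abs_catalanQ_shift_le (n J : ℕ) :
    |catalanQ n J n (J + n) n| ≤ 8 * ((J : ℚ) + 1) * ((J + n).choose n : ℚ) := by
  rw [catalanQ_eq_QClosed n J n (J + n) n (by omega), QClosed, qSum_eq_sum]
  calc |∑ i ∈ range (J + 1), qTerm n J n (J + n) n i|
      ≤ ∑ i ∈ range (J + 1), |qTerm n J n (J + n) n i| := Finset.abs_sum_le_sum_abs _ _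
    _ ≤ ∑ i ∈ range (J + 1), 8 * ((J + n).choose n : ℚ) := by
        refine Finset.sum_le_sum fun i hi => ?_
        have hiJ : i ≤ J := Nat.lt_succ_iff.mp (Finset.mem_range.mp hi)
        calc |qTerm n J n (J + n) n i| ≤ 8 * ((n + i).choose n : ℚ) := abs_qTerm_shift_le n J i hiJ
          _ ≤ 8 * ((J + n).choose n : ℚ) :=
              mul_le_mul_of_nonneg_left (by exact_mod_cast Nat.choose_le_choose n (by omega : n + i ≤ J + n))
                (by norm_num)
    _ = 8 * ((J : ℚ) + 1) * ((J + n).choose n : ℚ) := by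
        rw [Finset.sum_const, Finset.card_range, nsmul_eq_mul]; push_cast; ring

/-! ### The entropy bound for binomial coefficients -/

/-- On the rays: `C((j+1)n, n) · j^(jn) ≤ (j+1)^((j+1)n)`. -/
theorem choose_ray_mul_pow_le (j n : ℕ) :
    ((j + 1) * n).choose n * j ^ (j * n) ≤ (j + 1) ^ ((j + 1) * n) := by
  rcases Nat.eq_zero_or_pos n with rfl | hn
  · simp
  have h := Literature.InformationTheory.Entropy.choose_mul_pow_mul_pow_le n (j * n)
  have hs : n + j * n = (j + 1) * n := by ring
  rw [hs] at h
  -- cancel the common factor `n^((j+1)n)`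
  have hpow : ((j + 1) * n) ^ ((j + 1) * n) = (j + 1) ^ ((j + 1) * n) * n ^ ((j + 1) * n) := by
    rw [mul_pow]
  have hjn : (j * n) ^ (j * n) = j ^ (j * n) * n ^ (j * n) := by rw [mul_pow]
  have hnn : n ^ n * n ^ (j * n) = n ^ ((j + 1) * n) := by rw [← pow_add, hs]
  have key : ((j + 1) * n).choose n * j ^ (j * n) * n ^ ((j + 1) * n)
      ≤ (j + 1) ^ ((j + 1) * n) * n ^ ((j + 1) * n) := by
    calc ((j + 1) * n).choose n * j ^ (j * n) * n ^ ((j + 1) * n)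
        = ((j + 1) * n).choose n * n ^ n * (j * n) ^ (j * n) := by rw [hjn, ← hnn]; ring
      _ ≤ ((j + 1) * n) ^ ((j + 1) * n) := h
      _ = (j + 1) ^ ((j + 1) * n) * n ^ ((j + 1) * n) := hpow
  exact Nat.le_of_mul_le_mul_right key (by positivity)

/-- The growth rate of the `G`-coefficient on the `j`-th ray: `b_j = (j+1) log (j+1) − j log j`
(the entropy of `C((j+1)n, n)`; 3.1395… for `j = 8`). -/
noncomputable def bRate (j : ℕ) : ℝ := ((j : ℝ) + 1) * Real.log ((j : ℝ) + 1) - (j : ℝ) * Real.log j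

/-- `C((j+1)n, n) ≤ exp (b_j n)` for `j ≥ 1`. -/
theorem choose_ray_le_exp (j n : ℕ) (hj : 1 ≤ j) :
    ((((j + 1) * n).choose n : ℕ) : ℝ) ≤ Real.exp (bRate j * n) := by
  have hj0 : (0 : ℝ) < j := by exact_mod_cast hj
  have hj1 : (0 : ℝ) < (j : ℝ) + 1 := by linarith
  have h : ((((j + 1) * n).choose n : ℕ) : ℝ) * (j : ℝ) ^ (j * n) ≤ ((j : ℝ) + 1) ^ ((j + 1) * n) := by
    exact_mod_cast choose_ray_mul_pow_le j n
  have hpj : (0 : ℝ) < (j : ℝ) ^ (j * n) := pow_pos hj0 _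
  rw [← le_div_iff₀ hpj] at h
  refine h.trans (le_of_eq ?_)
  rw [← Real.exp_log (pow_pos hj1 ((j + 1) * n)), ← Real.exp_log hpj, ← Real.exp_sub, Real.log_pow, Real.log_pow,
    bRate]
  push_cast
  ring_nf

/-- **The `G`-coefficient on the rays grows at most like `e^{b_j n}`**:
`|Q(n, jn, n, (j+1)n, n)| ≤ 8 (jn+1) · exp (b_j n)` for all `n` (`j ≥ 1`). -/
theorem abs_catalanQ_ray_le_exp (j n : ℕ) (hj : 1 ≤ j) :
    |((catalanQ n (j * n) n ((j + 1) * n) n : ℚ) : ℝ)| ≤ 8 * ((j * n : ℕ) + 1) * Real.exp (bRate j * n) := by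
  have hs : (j + 1) * n = j * n + n := by ring
  have hQ : (|catalanQ n (j * n) n ((j + 1) * n) n| : ℝ)
      ≤ ((8 * ((j * n : ℕ) + 1 : ℚ) * (((j * n + n).choose n : ℕ) : ℚ) : ℚ) : ℝ) := by
    rw [hs]; exact_mod_cast abs_catalanQ_shift_le n (j * n)
  refine hQ.trans ?_
  push_cast
  have hC := choose_ray_le_exp j n hj
  rw [hs] at hC
  have h8 : (0 : ℝ) ≤ 8 * ((j : ℝ) * n + 1) := by positivity
  exact mul_le_mul_of_nonneg_left hC h8

end Summit.KontsevichZagierPeriods.Zeta5Search.CatalanTwoAdicSeries
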